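import Literature.MathematicalPhysics.QuantumFieldTheory.Balaban1983to89.Beta.WilsonVertex
import Literature.MathematicalPhysics.QuantumFieldTheory.Balaban1983to89.BlockAveragingEMLLinearisedBackground
import Literature.MathematicalPhysics.QuantumFieldTheory.Balaban1983to89.T3DescentFibreTower
import HarnessLib

/-!
# S2β · (β-3)′ FILE B₁ — THE LOOP WORDS OF (0.4) WITH DIRECTION-CONSTANT DATA: ZERO LETTER SUMS, THE COMMUTATOR SUM PER INDEX, AND ITS CANCELLATION OVER THE
# SYMMETRIC INDEX SET («THE SYMMETRIC COMB KILLS THE SECOND VARIATION», algebraic half); `Q₁^{R₀}(1)X̄ = L•A_μ` at the flat background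

Cell `ym3-torus` (YM ladder rung R3 = continuum `SU(2)` Yang–Mills on the three-torus at fixed lattice data — a RUNG: NOT d = 4, NOT infinite volume, NOT a mass gap,
NOT Clay).  Width seat `ym3-torus-px13` (gen 27); crux `stmt-QuantumFields-20520`, LINE g18-1 S2β, pairing lane; (SCT″-c)₁ source budget (S-SRC); ARCHITECT RULING px17 g22 19:55:50Z
«(β-3)′ YES» (order-2 brick in OSCILLATION form, cure of HAZARD «SRC-q (2)»).  ✓p833442 (FILE A, OSC SPLIT) reduced (β-3)′ to the structural letter CONST on constant fields; THIS FILE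
is CONST's ALGEBRAIC half — pure word∕list algebra over lit ✓`Beta.TransportVertices` (`commSum`) ∕ ✓`Beta.WilsonVertex` (`commSum_append'`, `commSum_reverse_map_neg`), ✓`T4Continuum`∕`BlockAveraging` (loop words, `netDisp`, `Idx`, `off`, `idxRefl`) and
✓`BlockAveragingEMLLinearised(Background)` (`walkSum`, `covLinAvgR0`, `sum_idx_swap`); the analytic half (mean of logs cubic, the title inequality) is FILE B₂ `…S2BetaChartReadConstFlat`.
`--kind proof --supports stmt-QuantumFields-20520 --as helper`, count-neutral, DEFINITION-FREE (0 `def`, 0 `instance`, 0 `notation`, 0 `sorry`, default heartbeats); generic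
`P : Params`, any normed ring.

THE MECHANISM ([Balaban1987RG1] (0.3)–(0.4) pp.252–253: loop words `Γ^σ(n) ∪ [x,x′] ∪ (−Γ^{σ′}(n)) ∪ (−c)` over `I = {offsets n} × S_d × S_d`).  With direction-constant data `a_κ`
the signed letter list of a word `w` has sum `Σ_κ netDisp_κ(w)•a_κ` (§1), zero on the CLOSED loop words (§3); its ordered commutator sum (lit `commSum`, the second-order term of
`Πe^{±a_κ}` by [Balaban1985BackgroundPropagators] (3.6)) is `commSum(loop_{(n,σ,σ′)}) = C(σ,n) − C(σ′,n) + 2(ν_nτ − τν_n)`, `ν_n = Σ_κ n_κ•a_κ`, `τ = L•a_μ` (§3, from the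
rules lit ✓`commSum_append'` ∕ `commSum_reverse_map_neg` and §2's `commSum_replicate`), and `Σ_{i∈I} commSum(loop_i) = 0` (§4): the staircase parts cancel under `σ ↔ σ′` (lit ✓`sum_idx_swap`), the cross term
because `Σ_n ν_n = 0` (centred offsets, `L` odd: lit ✓`idxRefl`, ✓`off_revAt`).  At the flat background the covariant linearised average of [Balaban1985Averaging] (124)–(125) of
direction-constant data is `L•a_μ` EXACTLY (§4 ★`covLinAvgR0_one_dirConst`: per index the two staircase sums coincide and cancel).

WHAT IS PROVED (sorry-free).  §1 `map_walk_eq_map`, `sum_map_signed_eq`.  §2 `commSum_replicate` (concatenation and the reversed inverse word are lit ✓`Beta.WilsonVertex.commSum_append'` ∕ `commSum_reverse_map_neg`, used BY NAME).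
§3 `map_signed_wordRev`, `map_signed_replicate`, `sum_map_signed_loopWord`, `sum_map_signed_stairWord`, `sum_map_signed_replicate`, ★★`commSum_map_signed_loopWord`.
§4 `walkSum_walk_dirConst`, ★`covLinAvgR0_one_dirConst`, `sum_idx_off_eq_zero`, `sum_idx_stairSum_eq_zero`, ★★`sum_idx_commSum_loop_eq_zero`.

HONEST.  Bookkeeping identities; nothing of Bałaban's analysis is asserted; CONST (flat: FILE B₂; curved: FILE C), rows v2, (SCT″-c)₁₂₃, (ST‴), LOC‴, GAP♯∘ (`stub_uniformFibreGapOrbit`,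
registry 3732b7df UNTOUCHED, 0∕5), the five REGISTERED stubs, S2β, crux 20520, 19936, 19200, `YM3TorusSU2` — NOT proved; rung R3 = SU(2) YM₃ on T³ — NOT d = 4, NOT infinite volume,
NOT a mass gap, NOT Clay; the Yang–Mills mass gap is NOT proved.  Axioms standard.

References: [Balaban1987RG1] T. Bałaban, CMP **109** (1987) 249–301, (0.3)–(0.4) pp.252–253; [Balaban1985Averaging] CMP **98** (1985) 17–51, (58) p.27, (124)–(125) p.36;
[Balaban1985BackgroundPropagators] CMP **99** (1985) 389–434, (3.6) p.391; [Balaban1984PropagatorsI] CMP **95** (1984) 17–40, (1.8) p.19.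
-/

set_option autoImplicit false

noncomputable section

open scoped Matrix.Norms.L2Operator

namespace Summit.QuantumFields.YangMills.Theorems.FluctuationComparisonRegPrIntLS2BetaLoopWordCommutators

open Literature.MathematicalPhysics.QuantumFieldTheory.Balaban1983to89
open Literature.MathematicalPhysics.QuantumFieldTheory.Balaban1983to89.T4Continuum (walk holAt LStep loopWord netDisp Letter stairWord wordRev)
open Literature.MathematicalPhysics.QuantumFieldTheory.Balaban1983to89.Beta.TransportVertices (holonomy size quad commSum)
open Literature.MathematicalPhysics.QuantumFieldTheory.Balaban1983to89.Beta.WilsonVertex (commSum_append' commSum_reverse_map_neg sum_reverse_map_neg)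

/-! ## §1 Words and walks for direction-constant data -/

section Words

variable {P : Params} {j : ℕ}

/-- Along a walk, a step function that only reads the direction and the orientation of each step is the letter function of the word. [folklore] -/
theorem map_walk_eq_map {β : Type*} (F : Fin P.d → Bool → β) :
    ∀ (x : Site P j) (w : List (Letter P.d)), (walk x w).map (fun s : LStep P j => F s.bond.dir s.fwd) = w.map (fun l => F l.1 l.2)
  | _, [] => rfl
  | x, (μ, true) :: w => by
    simp only [walk, List.map_cons, map_walk_eq_map F (x.shift μ) w]
  | x, (μ, false) :: w => by
    simp only [walk, List.map_cons, map_walk_eq_map F (x.unshift μ) w]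

variable {V : Type*} [AddCommGroup V]

/-- The signed letter sum of a word with direction-constant data is `Σ_κ (net displacement)_κ • a_κ`. [folklore] -/
theorem sum_map_signed_eq (a : Fin P.d → V) :
    ∀ w : List (Letter P.d), (w.map (fun l => if l.2 then a l.1 else -(a l.1))).sum = ∑ κ, (netDisp w κ) • a κ
  | [] => by simp [netDisp]
  | (μ, b) :: w => by
    rw [List.map_cons, List.sum_cons, sum_map_signed_eq a w]
    simp only [T4Continuum.netDisp_cons, add_smul, Finset.sum_add_distrib]
    congr 1
    rw [Finset.sum_eq_single μ (fun κ _ hκ => by rw [if_neg (Ne.symm hκ), zero_smul]) (fun h => absurd (Finset.mem_univ μ) h)]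
    cases b <;> simp

end Words

/-! ## §2 The ordered commutator sum of a constant list (concatenation ∕ reversed inverse word: lit ✓`Beta.WilsonVertex.commSum_append'` ∕ `commSum_reverse_map_neg`, BY NAME) -/

section CommSum

variable {𝔸 : Type*} [NormedRing 𝔸]

/-- A constant list has no commutators. [folklore] -/
theorem commSum_replicate (m : ℕ) (b : 𝔸) : commSum (List.replicate m b) = 0 := by
  induction m with
  | zero => simp
  | succ m ih =>
    rw [List.replicate_succ, Beta.TransportVertices.commSum_cons, ih, List.sum_replicate, smul_mul_assoc, mul_smul_comm, sub_self, add_zero]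

end CommSum

/-! ## §3 The signed letter list of a loop word of (0.4): zero sum, and the commutator sum per index -/

section LoopList

variable {P : Params} {𝔸 : Type*}

section Additive

variable [AddCommGroup 𝔸]

/-- The signed letter list of a reversed word is the reversed negated list. [folklore] -/
theorem map_signed_wordRev (a : Fin P.d → 𝔸) (w : List (Letter P.d)) :
    (wordRev w).map (fun l => if l.2 then a l.1 else -(a l.1)) = (w.map (fun l => if l.2 then a l.1 else -(a l.1))).reverse.map Neg.neg := by
  rw [wordRev, List.map_reverse, List.map_reverse, List.map_map, List.map_map]
  congr 2
  funext l
  obtain ⟨μ, b⟩ := l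
  cases b <;> simp [Letter.flip]

/-- The signed letter list of a run is a constant list. [folklore] -/
theorem map_signed_replicate (a : Fin P.d → 𝔸) (m : ℕ) (μ : Fin P.d) (b : Bool) :
    (List.replicate m (μ, b)).map (fun l => if l.2 then a l.1 else -(a l.1)) = List.replicate m (if b then a μ else -(a μ)) := by
  rw [List.map_replicate]

/-- The signed letter sum of a loop word of (0.4) vanishes (the loop is closed). [cite: Balaban1987RG1, (0.4) p.253] -/
theorem sum_map_signed_loopWord (a : Fin P.d → 𝔸) (μ : Fin P.d) (n : Fin P.d → ℤ) (σ σ' : Equiv.Perm (Fin P.d)) :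
    ((loopWord P.L μ n σ σ').map (fun l => if l.2 then a l.1 else -(a l.1))).sum = 0 := by
  rw [sum_map_signed_eq]
  simp [T4Continuum.netDisp_loopWord]

/-- The signed letter sum of a staircase is `Σ_κ n_κ • a_κ`, whatever the ordering. [cite: Balaban1987RG1, (0.3) p.252] -/
theorem sum_map_signed_stairWord (a : Fin P.d → 𝔸) (n : Fin P.d → ℤ) (σ : Equiv.Perm (Fin P.d)) :
    ((stairWord σ n).map (fun l => if l.2 then a l.1 else -(a l.1))).sum = ∑ κ, (n κ) • a κ := by
  rw [sum_map_signed_eq]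
  simp [T4Continuum.netDisp_stairWord]

/-- The signed letter sum of the transported bond `[x, x + L e_μ]` is `L • a_μ`. [cite: Balaban1987RG1, (0.4) p.253] -/
theorem sum_map_signed_replicate (a : Fin P.d → 𝔸) (m : ℕ) (μ : Fin P.d) :
    ((List.replicate m (μ, true)).map (fun l => if l.2 then a l.1 else -(a l.1))).sum = m • a μ := by
  rw [map_signed_replicate, List.sum_replicate, if_pos rfl]

end Additive

variable [NormedRing 𝔸]

/-- ★ **THE COMMUTATOR SUM OF A LOOP WORD**: with `ν = Σ_κ n_κ • a_κ` (the staircase sum), `τ = L • a_μ` (the transported bond) and `C(σ) = commSum` of the staircase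
`Γ^σ(n)`, `commSum(loop_{(n,σ,σ′)}) = C(σ) − C(σ′) + 2(ντ − τν)`. [cite: Balaban1987RG1, (0.4) p.253] -/
theorem commSum_map_signed_loopWord (a : Fin P.d → 𝔸) (μ : Fin P.d) (n : Fin P.d → ℤ) (σ σ' : Equiv.Perm (Fin P.d)) :
    commSum ((loopWord P.L μ n σ σ').map (fun l => if l.2 then a l.1 else -(a l.1))) =
      commSum ((stairWord σ n).map (fun l => if l.2 then a l.1 else -(a l.1))) - commSum ((stairWord σ' n).map (fun l => if l.2 then a l.1 else -(a l.1))) +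
        2 • ((∑ κ, (n κ) • a κ) * (P.L • a μ) - (P.L • a μ) * (∑ κ, (n κ) • a κ)) := by
  simp only [loopWord, List.map_append, commSum_append', map_signed_wordRev, commSum_reverse_map_neg, List.sum_append, sum_reverse_map_neg,
    sum_map_signed_stairWord, map_signed_replicate, commSum_replicate, List.sum_replicate, Bool.false_eq_true, ↓reduceIte, smul_neg]
  generalize (∑ κ, n κ • a κ) = ν
  generalize P.L • a μ = τ
  rw [two_nsmul]
  noncomm_ring

end LoopList

/-! ## §4 The flat background: `Q₁^{R₀}(1)` of direction-constant data is `L•a_μ`; the commutator means cancel over the symmetric index set -/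

section Flat

open Literature.MathematicalPhysics.QuantumFieldTheory.Balaban1983to89.BlockAveraging (Idx off idxRefl revAt off_revAt)
open Literature.MathematicalPhysics.QuantumFieldTheory.Balaban1983to89.BlockAveragingEMLLinearised (walkSum walkSum_cons walkSum_nil sum_idx_swap)
open Literature.MathematicalPhysics.QuantumFieldTheory.Balaban1983to89.BlockAveragingEMLLinearisedBackground (covLinAvgR0 covWalkSum_one)

variable {P : Params} {j : ℕ} {n : Type*} [Fintype n] [DecidableEq n] [Nonempty n]

/-- The signed sum of direction-constant data along a walk is the signed letter sum of the word. [cite: Balaban1984PropagatorsI, (1.8) p.19] -/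
theorem walkSum_walk_dirConst {V : Type*} [AddCommGroup V] (a : Fin P.d → V) :
    ∀ (x : Site P j) (w : List (Letter P.d)), walkSum (fun b : PBond P j => a b.dir) (walk x w) = (w.map (fun l => if l.2 then a l.1 else -(a l.1))).sum
  | _, [] => by simp [walk]
  | x, (μ, true) :: w => by
    simp only [walk, walkSum_cons, List.map_cons, List.sum_cons, walkSum_walk_dirConst a (x.shift μ) w, if_true]
  | x, (μ, false) :: w => by
    simp only [walk, walkSum_cons, List.map_cons, List.sum_cons, walkSum_walk_dirConst a (x.unshift μ) w, Bool.false_eq_true, if_false]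

/-- ★ **AT THE FLAT BACKGROUND THE COVARIANT LINEARISED AVERAGE OF DIRECTION-CONSTANT DATA IS `L•a_μ`** (the two staircase sums are the same `Σ_κ n_κ•a_κ` and cancel
per index; the transported bond contributes `L•a_μ`). [cite: Balaban1985Averaging, (124)-(125) p.36] -/
theorem covLinAvgR0_one_dirConst (a : Fin P.d → Matrix n n ℂ) (c : PBond P (j + 1)) :
    covLinAvgR0 (1 : GaugeField P j (Matrix.specialUnitaryGroup n ℂ)) (fun b : PBond P j => a b.dir) c = P.L • a c.dir := by
  unfold covLinAvgR0
  simp only [covWalkSum_one, T3DescentFibreTower.holAt_one, mul_one, inv_one, OneMemClass.coe_one, star_one, one_mul, walkSum_walk_dirConst,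
    sum_map_signed_stairWord, sum_map_signed_replicate, add_sub_cancel_left, Finset.sum_const, Finset.card_univ]
  rw [← Nat.cast_smul_eq_nsmul ℂ (Fintype.card (Idx P)), smul_smul, inv_mul_cancel₀ (Nat.cast_ne_zero.2 Fintype.card_ne_zero), one_smul]

/-- The centred offsets sum to zero over the block (reflection `r_κ ↦ L − 1 − r_κ`, `L` odd). [cite: Balaban1987RG1, (0.3) p.252] -/
theorem sum_idx_off_eq_zero (κ : Fin P.d) : ∑ i : Idx P, off i.1 κ = 0 := by
  have h : ∑ i : Idx P, off ((idxRefl κ) i).1 κ = ∑ i : Idx P, off i.1 κ :=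
    Fintype.sum_equiv (idxRefl κ) (fun i => off ((idxRefl κ) i).1 κ) (fun i => off i.1 κ) (fun _ => rfl)
  have h2 : ∀ i : Idx P, off ((idxRefl κ) i).1 κ = -off i.1 κ := fun i => by
    show off (revAt κ i.1) κ = -off i.1 κ
    rw [off_revAt]
    simp [T4Continuum.negAt]
  simp only [h2, Finset.sum_neg_distrib] at h
  linarith

/-- The staircase sums `Σ_κ n_κ•a_κ` sum to zero over the index set. [cite: Balaban1987RG1, (0.3)-(0.4) pp.252-253] -/
theorem sum_idx_stairSum_eq_zero {V : Type*} [AddCommGroup V] (a : Fin P.d → V) : ∑ i : Idx P, ∑ κ, (off i.1 κ) • a κ = 0 := by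
  rw [Finset.sum_comm]
  refine Finset.sum_eq_zero fun κ _ => ?_
  rw [← Finset.sum_smul, sum_idx_off_eq_zero, zero_smul]

/-- ★★ **THE SYMMETRIC COMB KILLS THE SECOND VARIATION**: over the (0.4) index set `I = {offsets} × S_d × S_d` the commutator sums of the loop lists CANCEL —
the staircase parts `C(σ) − C(σ′)` by the `σ ↔ σ′` symmetry of `I`, the cross term `2(ντ − τν)` because the centred offsets have mean zero. [cite: Balaban1987RG1, (0.4) p.253; Balaban1985Averaging, Prop. 3 (123) p.36] -/
theorem sum_idx_commSum_loop_eq_zero {𝔸 : Type*} [NormedRing 𝔸] (a : Fin P.d → 𝔸) (μ : Fin P.d) :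
    ∑ i : Idx P, commSum ((loopWord P.L μ (off i.1) i.2.1 i.2.2).map (fun l => if l.2 then a l.1 else -(a l.1))) = 0 := by
  simp only [commSum_map_signed_loopWord]
  have hsw := sum_idx_swap (fun (r : Fin P.d → Fin P.L) (σ : Equiv.Perm (Fin P.d)) => commSum ((stairWord σ (off r)).map (fun l => if l.2 then a l.1 else -(a l.1))))
  beta_reduce at hsw
  rw [Finset.sum_add_distrib, Finset.sum_sub_distrib, hsw, sub_self, zero_add, ← Finset.smul_sum, Finset.sum_sub_distrib,
    ← Finset.sum_mul, ← Finset.mul_sum, sum_idx_stairSum_eq_zero, zero_mul, mul_zero, sub_self, smul_zero]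

end Flat

end Summit.QuantumFields.YangMills.Theorems.FluctuationComparisonRegPrIntLS2BetaLoopWordCommutators

end
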